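import Literature.Probability.LatticeModels.FieldScalingLimitProofs
import Literature.Probability.LatticeModels.MagnetizationExponentUpperDischarge
import HarnessLib

/-!
# Discharges of named facts of `FieldScalingLimit.lean`

`Literature/Probability/LatticeModels/FieldScalingLimitDischarges.lean` — proofs-only sibling
of `FieldScalingLimit.lean` (no definitions, no named facts). Each theorem below closes a
named fact `X : Prop` of that file as `X_holds : X` by composing an ACCEPTED reduction theorem
of the tree with the ACCEPTED unconditional `_holds` discharges of all of its hypotheses;
nothing is re-proved and no statement is changed. Recorded by the librarian sweep g25
(2026-08-16, pass 5c: facts dischargeable in one line from the tree's own lemmas), so that the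
facts census, `#h21_route_deps` and the cone guardrail see these facts as theorems.

Discharged here:

* `aizenman_fernandez_magnetization_holds` := `aizenman_fernandez_magnetization_of_le_sqrt`
  `spontaneousMagnetization_le_sqrt_holds` (`FieldScalingLimitProofs.lean`).

## References

* [AizenmanFernandezJSP1986] — see `lean/references.bib` and the docstring of the fact in `FieldScalingLimit.lean`.
-/

namespace Literature.Probability.LatticeModels

/-- **Discharge of the named fact `aizenman_fernandez_magnetization`** (`FieldScalingLimit.lean`):
crit-ising.S13 (known theorem; mean-field magnetisation exponent above four dimensions). … —
obtained as `aizenman_fernandez_magnetization_of_le_sqrt` applied to the tree's unconditional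
discharge `spontaneousMagnetization_le_sqrt_holds` of its hypothesis (reduction in
`FieldScalingLimitProofs.lean`).
[cite: AizenmanFernandezJSP1986, main results (mean-field exponent β̂ = 1/2 for d > 4 under the bubble condition)] -/
theorem aizenman_fernandez_magnetization_holds :
    aizenman_fernandez_magnetization :=
  aizenman_fernandez_magnetization_of_le_sqrt spontaneousMagnetization_le_sqrt_holds

end Literature.Probability.LatticeModels
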